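import Mathlib
import Summits.CriticalPhenomena.PercolationContinuityZ3.Theorems.PercNearOneGluingAdditiveGluingGoodStepFibres
import Summits.CriticalPhenomena.PercolationContinuityZ3.Theorems.PercNearOneGluingAdditiveGluingLemma5AnyRelay
import HarnessLib

/-! # Crux `PercNearOneGluing.AdditiveGluing` (stmt-CriticalPhenomena-4576), line `subuniform-dead-pocket-maximum` —
# the inductive step `stub_goodStep` REDUCED to its purely-low multi-fibres strictly below the worst relay off `o`

Third of three helper files (siege seat k13 on `stub_goodStep`).  Lands with
`--supports stmt-CriticalPhenomena-4576`.  Notation as in `…GoodStepLeaf`, `…GoodStepFibres`;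
`a₀ ∈ A` is a minimiser of `τ°(x) = μ(x ↔ b in {o}ᶜ)` over `A`.

## Content

1. **The selection-form step is a SUM OF FIBRE INEQUALITIES** (exact bookkeeping inside
   `goodStepK13_of_lowFibres`): the conclusion of `stub_goodStep` at `(w, A, o, b)` follows from the designated
   inequality `μ(a₀ ↔ b) ≤ μ(o ↔ b) + Σ_{W ∋ o, W ∩ A = ∅} μ(C(o) = W) · μ(sel W ↔ b in Wᶜ)` (every selection
   `sel`), and this inequality is the sum over the open star `B` of `o` of the fibre inequalities
   `μ(σ_B ∩ {a₀ ↔ b}) ≤ μ(σ_B ∩ {o ↔ b}) + Σ_W μ(σ_B ∩ {C(o) = W}) · μ(sel W ↔ b in Wᶜ)`.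
2. **Which fibres are free**: `o ∈ B` (empty); `B = ∅` (equality up to `τ°(sel {o}) ≥ τ°(a₀)`); `B ∋ v` with
   `τ°(a₀) ≤ τ°(v)` — in particular every `B` meeting `A` — by Kozma–Nitzan's Lemma 5 for an arbitrary relay
   (`stub_lemma5AnyRelay`, landed); `B` with a weight-`0` pair at `o` (null); the SINGLETON low fibres
   `B = {y}` (`goodStepK13_fibre_singleton`: the induction hypothesis at `w⁰`, which has fewer positive-degree
   vertices, `goodStepK13_card_lt`).
3. **`goodStepK13_of_lowFibres`** — the inductive step holds at `(w, A, o, b)` PROVIDED the fibre inequality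
   holds for every `B` with `2 ≤ |B|` all of whose vertices are low (`∉ A`, `≠ o`), joined to `o` by
   positive-weight pairs and STRICTLY less reliable than `a₀` off `o`.  These purely-low multi-fibres are the
   exact residue of the line at this stub: in the contracted graph `(G − o) + K_B` the fibre inequality reads
   "the glued observer `B` dominates the relay `a₀` that is worst BEFORE gluing" (re-ordering by gluing;
   numerically 0 violations, exact equality on symmetric tie loci — seat note on the crux item).
4. COROLLARY (not restated here: it is the sibling seats' landed `stub_goodStepOneLowViaCorner_k4` /
   `stub_goodStepUniqueLow_k24`, and follows from item 3 in eight lines since a purely-low positively attached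
   `B` then has at most one element): the full conclusion of `stub_goodStep` when `o` has at most one low
   neighbour of positive weight — the class of Kozma–Nitzan's Theorem 5 (arXiv:2401.12397 pp. 13–14).
   Relative to the corner reduction `stub_goodStepCorner_k4` (glued-measure form, residue = all positive low
   layers), the residue here is smaller: layers containing a low vertex `v` with `τ°(a₀) ≤ τ°(v)` are
   discharged by Lemma 5 with that `v`, so only layers STRICTLY below `a₀` off `o` remain.

No new definitions. -/

namespace Summit.CriticalPhenomena.PercolationContinuityZ3.Theorems

open MeasureTheory Set
open Literature.Probability.LatticeModels (prodBernoulli)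
open Literature.Probability.Percolation (BondConfig openConn openConnIn openGraph openCluster
  openGraph_adj DeterminedBy determinedBy_iff PathIn)

noncomputable section
open Classical

variable {n : ℕ}

/-! ### The step from its fibres -/

/-- **`stub_goodStep` reduced to its purely-low multi-fibres.**  Hypotheses of `stub_goodStep` at
`(w, A, o, b)` (low neighbour, induction hypothesis), a minimiser `a₀ ∈ A` of `τ°` over `A`, and the
fibre inequality
`μ(σ_B ∩ {a₀ ↔ b}) ≤ μ(σ_B ∩ {o ↔ b}) + Σ_{W ∋ o, W ∩ A = ∅} μ(σ_B ∩ {C(o) = W}) · μ(sel W ↔ b in Wᶜ)`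
for every selection `sel` and every `B` with `2 ≤ |B|` whose vertices are all `∉ A`, `≠ o`, joined to
`o` by positive-weight pairs and strictly less reliable than `a₀` off `o`.  CONCLUSION: the selection-form
goodness of `(w, A, o, b)` (the conclusion of `stub_goodStep`).  Proof: designated form + fibre sum
(module docstring, items 1–2); the fibres `B ∩ A ≠ ∅` and `B ∋ v` with `τ°(a₀) ≤ τ°(v)` are KN Lemma 5
(`stub_lemma5AnyRelay`), `B = ∅` is equality, null fibres vanish, the singleton low fibres are the
induction hypothesis at `w⁰` (`goodStepK13_fibre_singleton`, `goodStepK13_card_lt`).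
(Kozma–Nitzan arXiv:2401.12397 §3.2, proofs of Thms 4–5 pp. 13–14, generalised.) -/
theorem goodStepK13_of_lowFibres (w : Sym2 (Fin n) → unitInterval) (A : Finset (Fin n)) (o b a₀ : Fin n)
    (hbA : b ∈ A) (hoA : o ∉ A) (hlow : ∃ y : Fin n, y ∉ A ∧ y ≠ o ∧ (w s(o, y) : ℝ) ≠ 0)
    (ih : ∀ w' : Sym2 (Fin n) → unitInterval,
        (Finset.univ.filter (fun v : Fin n => ∃ u : Fin n, 0 < (w' s(u, v) : ℝ))).card
          < (Finset.univ.filter (fun v : Fin n => ∃ u : Fin n, 0 < (w s(u, v) : ℝ))).card →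
        ∀ (A' : Finset (Fin n)) (o' b' : Fin n), b' ∈ A' → o' ∉ A' →
        ∀ (t : ℝ) (sel : Finset (Fin n) → Fin n), (∀ W, sel W ∈ A') →
          (∀ a ∈ A', 1 - t ≤ (prodBernoulli w').real (openConn a b')) →
          (prodBernoulli w').real ((⋃ a ∈ A', openConn o' a) ∩ (openConn o' b')ᶜ)
            + ∑ W ∈ (Finset.univ : Finset (Finset (Fin n))).filter (fun W => o' ∈ W ∧ Disjoint W A'),
                (prodBernoulli w').real {ω : BondConfig (Fin n) | openCluster ω o' = (W : Set (Fin n))}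
                  * (prodBernoulli w').real (openConnIn ((W : Set (Fin n))ᶜ) (sel W) b')ᶜ
            ≤ t)
    (ha₀A : a₀ ∈ A)
    (hmin : ∀ v ∈ A, (prodBernoulli w).real (openConnIn (({o} : Set (Fin n))ᶜ) a₀ b)
      ≤ (prodBernoulli w).real (openConnIn (({o} : Set (Fin n))ᶜ) v b))
    (hΨ : ∀ B : Finset (Fin n),
      (∀ z ∈ B, z ∉ A ∧ z ≠ o ∧ (w s(o, z) : ℝ) ≠ 0 ∧
        (prodBernoulli w).real (openConnIn (({o} : Set (Fin n))ᶜ) z b)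
          < (prodBernoulli w).real (openConnIn (({o} : Set (Fin n))ᶜ) a₀ b)) →
      2 ≤ B.card →
      ∀ (sel : Finset (Fin n) → Fin n), (∀ W, sel W ∈ A) →
        (prodBernoulli w).real
            ({ω : BondConfig (Fin n) | ∀ z : Fin n, z ≠ o → (s(o, z) ∈ ω ↔ z ∈ B)} ∩ openConn a₀ b) ≤
          (prodBernoulli w).real
              ({ω : BondConfig (Fin n) | ∀ z : Fin n, z ≠ o → (s(o, z) ∈ ω ↔ z ∈ B)} ∩ openConn o b) +
            ∑ W ∈ (Finset.univ : Finset (Finset (Fin n))).filter (fun W => o ∈ W ∧ Disjoint W A),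
              (prodBernoulli w).real
                  ({ω : BondConfig (Fin n) | ∀ z : Fin n, z ≠ o → (s(o, z) ∈ ω ↔ z ∈ B)} ∩
                    {ω : BondConfig (Fin n) | openCluster ω o = (W : Set (Fin n))})
                * (prodBernoulli w).real (openConnIn ((W : Set (Fin n))ᶜ) (sel W) b)) :
    ∀ (t : ℝ) (sel : Finset (Fin n) → Fin n), (∀ W, sel W ∈ A) →
      (∀ a ∈ A, 1 - t ≤ (prodBernoulli w).real (openConn a b)) →
      (prodBernoulli w).real ((⋃ a ∈ A, openConn o a) ∩ (openConn o b)ᶜ)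
        + ∑ W ∈ (Finset.univ : Finset (Finset (Fin n))).filter (fun W => o ∈ W ∧ Disjoint W A),
            (prodBernoulli w).real {ω : BondConfig (Fin n) | openCluster ω o = (W : Set (Fin n))}
              * (prodBernoulli w).real (openConnIn ((W : Set (Fin n))ᶜ) (sel W) b)ᶜ
        ≤ t := by
  intro t sel hsel hrel
  have hbo : b ≠ o := fun h => hoA (h ▸ hbA)
  have ha₀o : a₀ ≠ o := fun h => hoA (h ▸ ha₀A)
  set T := (Finset.univ : Finset (Finset (Fin n))).filter (fun W => o ∈ W ∧ Disjoint W A) with hTdef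
  -- the killed weights
  set w0 : Sym2 (Fin n) → unitInterval := fun e => if o ∈ e then 0 else w e with hw0def
  have hw0 : ∀ e, o ∈ e → w0 e = 0 := fun e he => by simp [hw0def, he]
  have hw0' : ∀ e, o ∉ e → w0 e = w e := fun e he => by simp [hw0def, he]
  obtain ⟨y₀, -, -, hy₀⟩ := hlow
  have hcard := goodStepK13_card_lt w w0 o y₀ hw0 hw0' hy₀
  -- (A) the designated inequality, fibre by fibre
  have hdes : (prodBernoulli w).real (openConn a₀ b) ≤ (prodBernoulli w).real (openConn o b) +
      ∑ W ∈ T, (prodBernoulli w).real {ω : BondConfig (Fin n) | openCluster ω o = (W : Set (Fin n))}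
        * (prodBernoulli w).real (openConnIn ((W : Set (Fin n))ᶜ) (sel W) b) := by
    set f : BondConfig (Fin n) → Finset (Fin n) :=
      fun ω => Finset.univ.filter fun z : Fin n => z ≠ o ∧ s(o, z) ∈ ω with hfdef
    have hpart : ∀ F : Set (BondConfig (Fin n)),
        (prodBernoulli w).real F = ∑ B : Finset (Fin n), (prodBernoulli w).real (f ⁻¹' {B} ∩ F) := fun F =>
      (sigmaRec_sum_preimage_inter w f F).symm
    -- termwise comparison on the fibres
    have hfib : ∀ B : Finset (Fin n), (prodBernoulli w).real (f ⁻¹' {B} ∩ openConn a₀ b) ≤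
        (prodBernoulli w).real (f ⁻¹' {B} ∩ openConn o b) +
          ∑ W ∈ T, (prodBernoulli w).real (f ⁻¹' {B} ∩ {ω : BondConfig (Fin n) | openCluster ω o = (W : Set (Fin n))})
            * (prodBernoulli w).real (openConnIn ((W : Set (Fin n))ᶜ) (sel W) b) := by
      intro B
      have hnn : 0 ≤ ∑ W ∈ T, (prodBernoulli w).real (f ⁻¹' {B} ∩ {ω : BondConfig (Fin n) | openCluster ω o = (W : Set (Fin n))})
            * (prodBernoulli w).real (openConnIn ((W : Set (Fin n))ᶜ) (sel W) b) :=
        Finset.sum_nonneg fun W _ => mul_nonneg measureReal_nonneg measureReal_nonneg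
      by_cases hoB : o ∈ B
      · simp [hfdef, goodBase_fibre_eq_empty o B hoB]
      by_cases hB0 : B = ∅
      · -- the empty star: equality up to the minimality of a₀
        subst hB0
        rw [hfdef, goodBase_fibre_empty o, goodBase_real_isolated_inter_openConn w o a₀ b ha₀o]
        have hmem : ({o} : Finset (Fin n)) ∈ T :=
          Finset.mem_filter.2 ⟨Finset.mem_univ _, Finset.mem_singleton_self o, Finset.disjoint_singleton_left.2 hoA⟩
        set g : Finset (Fin n) → ℝ := fun W => (prodBernoulli w).real
              ({ω : BondConfig (Fin n) | ∀ z : Fin n, z ≠ o → s(o, z) ∉ ω} ∩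
                {ω : BondConfig (Fin n) | openCluster ω o = (W : Set (Fin n))})
              * (prodBernoulli w).real (openConnIn ((W : Set (Fin n))ᶜ) (sel W) b) with hgdef
        have hsingle : g {o} ≤ ∑ W ∈ T, g W :=
          Finset.single_le_sum (f := g) (fun W _ => mul_nonneg measureReal_nonneg measureReal_nonneg) hmem
        have hinter : {ω : BondConfig (Fin n) | ∀ z : Fin n, z ≠ o → s(o, z) ∉ ω} ∩
            {ω : BondConfig (Fin n) | openCluster ω o = ((({o} : Finset (Fin n))) : Set (Fin n))} =
            {ω : BondConfig (Fin n) | ∀ z : Fin n, z ≠ o → s(o, z) ∉ ω} := by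
          refine Set.inter_eq_left.2 fun ω hω => ?_
          have hω' : ∀ z : Fin n, z ≠ o → s(o, z) ∉ ω := hω
          show openCluster ω o = ((({o} : Finset (Fin n))) : Set (Fin n))
          rw [Finset.coe_singleton]
          ext x
          simp only [openCluster, Set.mem_setOf_eq, Set.mem_singleton_iff]
          constructor
          · intro hx
            by_contra hxo
            obtain ⟨z, hzo, hz, -⟩ := goodBase_exists_open_pair hx hxo
            exact hω' z hzo hz
          · rintro rfl
            exact SimpleGraph.Reachable.refl _
        have hg : g {o} = (prodBernoulli w).real {ω : BondConfig (Fin n) | ∀ z : Fin n, z ≠ o → s(o, z) ∉ ω} *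
            (prodBernoulli w).real (openConnIn (({o} : Set (Fin n))ᶜ) (sel {o}) b) := by
          rw [hgdef]
          simp only []
          rw [hinter, Finset.coe_singleton]
        rw [hg] at hsingle
        have hm := hmin (sel {o}) (hsel {o})
        have hE : 0 ≤ (prodBernoulli w).real {ω : BondConfig (Fin n) | ∀ z : Fin n, z ≠ o → s(o, z) ∉ ω} :=
          measureReal_nonneg
        have hob : 0 ≤ (prodBernoulli w).real ({ω : BondConfig (Fin n) | ∀ z : Fin n, z ≠ o → s(o, z) ∉ ω} ∩ openConn o b) :=
          measureReal_nonneg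
        have hsum_eq : ∑ W ∈ T, g W = ∑ W ∈ T, (prodBernoulli w).real
              ({ω : BondConfig (Fin n) | ∀ z : Fin n, z ≠ o → s(o, z) ∉ ω} ∩
                {ω : BondConfig (Fin n) | openCluster ω o = (W : Set (Fin n))})
              * (prodBernoulli w).real (openConnIn ((W : Set (Fin n))ᶜ) (sel W) b) := rfl
        rw [hsum_eq] at hsingle
        nlinarith [mul_le_mul_of_nonneg_left hm hE, hsingle, hob]
      -- nonempty star avoiding o
      rw [hfdef, goodBase_fibre_eq o B hoB]
      by_cases hv : ∃ v ∈ B, (prodBernoulli w).real (openConnIn (({o} : Set (Fin n))ᶜ) a₀ b)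
          ≤ (prodBernoulli w).real (openConnIn (({o} : Set (Fin n))ᶜ) v b)
      · -- Lemma 5 (any relay, any B with a vertex at least as reliable as a₀ off o)
        obtain ⟨v, hvB, hle⟩ := hv
        have h5 := stub_lemma5AnyRelay n w o b a₀ v B hbo ha₀o hoB hvB hle
        rw [hfdef, goodBase_fibre_eq o B hoB] at hnn
        linarith
      push Not at hv
      by_cases hz : ∃ z ∈ B, (w s(o, z) : ℝ) = 0
      · -- a weight-0 pair at o is open on σ_B: null fibre
        obtain ⟨z, hzB, hz0⟩ := hz
        have hzo : z ≠ o := fun h => hoB (h ▸ hzB)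
        have hnull : (prodBernoulli w).real
            {ω : BondConfig (Fin n) | ∀ z : Fin n, z ≠ o → (s(o, z) ∈ ω ↔ z ∈ B)} = 0 :=
          sigmaRec_null w _ {s(o, z)} (fun e he => by
              rw [Finset.mem_singleton.1 he]
              exact Set.Icc.coe_eq_zero.1 hz0)
            fun ω hω => ⟨s(o, z), Finset.mem_singleton_self _, (hω z hzo).2 hzB⟩
        rw [measureReal_mono_null Set.inter_subset_left hnull]
        rw [hfdef, goodBase_fibre_eq o B hoB] at hnn
        linarith [(measureReal_nonneg : 0 ≤ (prodBernoulli w).real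
          ({ω : BondConfig (Fin n) | ∀ z : Fin n, z ≠ o → (s(o, z) ∈ ω ↔ z ∈ B)} ∩ openConn o b))]
      push Not at hz
      -- all vertices of B are low, positively attached, strictly below a₀ off o
      have hBlow : ∀ z ∈ B, z ∉ A ∧ z ≠ o ∧ (w s(o, z) : ℝ) ≠ 0 ∧
          (prodBernoulli w).real (openConnIn (({o} : Set (Fin n))ᶜ) z b)
            < (prodBernoulli w).real (openConnIn (({o} : Set (Fin n))ᶜ) a₀ b) := by
        intro z hzB
        refine ⟨fun hzA => ?_, fun h => hoB (h ▸ hzB), hz z hzB, hv z hzB⟩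
        exact absurd (hmin z hzA) (not_le.2 (hv z hzB))
      by_cases hcard2 : 2 ≤ B.card
      · exact hΨ B hBlow hcard2 sel hsel
      · -- B is a singleton {y}: the induction hypothesis at w0
        have hB1 : B.card = 1 := by
          have hpos : 0 < B.card := Finset.card_pos.2 (Finset.nonempty_iff_ne_empty.2 hB0)
          omega
        obtain ⟨y, rfl⟩ := Finset.card_eq_one.1 hB1
        obtain ⟨hyA, hyo, -, -⟩ := hBlow y (Finset.mem_singleton_self y)
        exact goodStepK13_fibre_singleton w w0 A o b a₀ y hw0 hw0' hbA hoA ha₀A hyo hmin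
          (ih w0 hcard A y b hbA hyA) sel hsel
    -- sum the fibres
    rw [hpart (openConn a₀ b), hpart (openConn o b)]
    have hsumW : ∑ W ∈ T, (prodBernoulli w).real {ω : BondConfig (Fin n) | openCluster ω o = (W : Set (Fin n))}
          * (prodBernoulli w).real (openConnIn ((W : Set (Fin n))ᶜ) (sel W) b) =
        ∑ B : Finset (Fin n), ∑ W ∈ T,
          (prodBernoulli w).real (f ⁻¹' {B} ∩ {ω : BondConfig (Fin n) | openCluster ω o = (W : Set (Fin n))})
            * (prodBernoulli w).real (openConnIn ((W : Set (Fin n))ᶜ) (sel W) b) := by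
      rw [Finset.sum_comm]
      refine Finset.sum_congr rfl fun W _ => ?_
      rw [hpart {ω : BondConfig (Fin n) | openCluster ω o = (W : Set (Fin n))}, Finset.sum_mul]
    rw [hsumW, ← Finset.sum_add_distrib]
    exact Finset.sum_le_sum fun B _ => hfib B
  -- (B) from the designated inequality to the selection form
  have hsub : (openConn o b : Set (BondConfig (Fin n))) ⊆ ⋃ a ∈ A, openConn o a := fun ω hω =>
    Set.mem_iUnion₂.2 ⟨b, hbA, hω⟩
  have hlive : (prodBernoulli w).real ((⋃ a ∈ A, openConn o a) ∩ (openConn o b)ᶜ) =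
      (prodBernoulli w).real (⋃ a ∈ A, (openConn o a : Set (BondConfig (Fin n)))) -
        (prodBernoulli w).real (openConn o b) := by
    rw [← Set.sdiff_eq, measureReal_sdiff hsub (Set.toFinite _).measurableSet (measure_ne_top _ _)]
  have hcov := goodStepK13_sum_le_one_sub w A o
  have hcompl : ∀ W : Finset (Fin n), (prodBernoulli w).real (openConnIn ((W : Set (Fin n))ᶜ) (sel W) b)ᶜ =
      1 - (prodBernoulli w).real (openConnIn ((W : Set (Fin n))ᶜ) (sel W) b) := fun W =>
    probReal_compl_eq_one_sub (Set.toFinite _).measurableSet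
  have hrel₀ := hrel a₀ ha₀A
  simp only [hcompl, mul_sub, mul_one, Finset.sum_sub_distrib]
  rw [hlive]
  linarith

/-- Registered form (`stub_goodStepLowFibres_k13` on stmt-CriticalPhenomena-4576) of `goodStepK13_of_lowFibres`:
**the inductive step `stub_goodStep` holds at `(w, A, o, b)` as soon as its purely-low multi-fibres
(`2 ≤ |B|`, all vertices of `B` low, positively attached, strictly below `a₀` off `o`) satisfy the fibre
inequality** — the exact residue of the line at this stub. (Kozma–Nitzan arXiv:2401.12397 §3.2, generalising
the proofs of Thms 4–5.) -/
theorem stub_goodStepLowFibres_k13 :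
    ∀ (n : ℕ) (w : Sym2 (Fin n) → unitInterval) (A : Finset (Fin n)) (o b a₀ : Fin n), b ∈ A → o ∉ A → (∃ y
      : Fin n, y ∉ A ∧ y ≠ o ∧ (w s(o, y) : ℝ) ≠ 0) → (∀ w' : Sym2 (Fin n) → unitInterval,
      (Finset.univ.filter (fun v : Fin n => ∃ u : Fin n, 0 < (w' s(u, v) : ℝ))).card < (Finset.univ.filter
      (fun v : Fin n => ∃ u : Fin n, 0 < (w s(u, v) : ℝ))).card → ∀ (A' : Finset (Fin n)) (o' b' : Fin n),
      b' ∈ A' → o' ∉ A' → ∀ (t : ℝ) (sel : Finset (Fin n) → Fin n), (∀ W, sel W ∈ A') → (∀ a ∈ A', 1 - t ≤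
      (prodBernoulli w').real (openConn a b')) → (prodBernoulli w').real ((⋃ a ∈ A', openConn o' a) ∩
      (openConn o' b')ᶜ) + ∑ W ∈ (Finset.univ : Finset (Finset (Fin n))).filter (fun W => o' ∈ W ∧ Disjoint
      W A'), (prodBernoulli w').real {ω : BondConfig (Fin n) | openCluster ω o' = (W : Set (Fin n))} *
      (prodBernoulli w').real (openConnIn ((W : Set (Fin n))ᶜ) (sel W) b')ᶜ ≤ t) → a₀ ∈ A → (∀ v ∈ A,
      (prodBernoulli w).real (openConnIn (({o} : Set (Fin n))ᶜ) a₀ b) ≤ (prodBernoulli w).real (openConnIn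
      (({o} : Set (Fin n))ᶜ) v b)) → (∀ B : Finset (Fin n), (∀ z ∈ B, z ∉ A ∧ z ≠ o ∧ (w s(o, z) : ℝ) ≠ 0 ∧
      (prodBernoulli w).real (openConnIn (({o} : Set (Fin n))ᶜ) z b) < (prodBernoulli w).real (openConnIn
      (({o} : Set (Fin n))ᶜ) a₀ b)) → 2 ≤ B.card → ∀ (sel : Finset (Fin n) → Fin n), (∀ W, sel W ∈ A) →
      (prodBernoulli w).real ({ω : BondConfig (Fin n) | ∀ z : Fin n, z ≠ o → (s(o, z) ∈ ω ↔ z ∈ B)} ∩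
      openConn a₀ b) ≤ (prodBernoulli w).real ({ω : BondConfig (Fin n) | ∀ z : Fin n, z ≠ o → (s(o, z) ∈ ω
      ↔ z ∈ B)} ∩ openConn o b) + ∑ W ∈ (Finset.univ : Finset (Finset (Fin n))).filter (fun W => o ∈ W ∧
      Disjoint W A), (prodBernoulli w).real ({ω : BondConfig (Fin n) | ∀ z : Fin n, z ≠ o → (s(o, z) ∈ ω ↔
      z ∈ B)} ∩ {ω : BondConfig (Fin n) | openCluster ω o = (W : Set (Fin n))}) * (prodBernoulli w).real
      (openConnIn ((W : Set (Fin n))ᶜ) (sel W) b)) → ∀ (t : ℝ) (sel : Finset (Fin n) → Fin n), (∀ W, sel W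
      ∈ A) → (∀ a ∈ A, 1 - t ≤ (prodBernoulli w).real (openConn a b)) → (prodBernoulli w).real ((⋃ a ∈ A,
      openConn o a) ∩ (openConn o b)ᶜ) + ∑ W ∈ (Finset.univ : Finset (Finset (Fin n))).filter (fun W => o ∈
      W ∧ Disjoint W A), (prodBernoulli w).real {ω : BondConfig (Fin n) | openCluster ω o = (W : Set (Fin
      n))} * (prodBernoulli w).real (openConnIn ((W : Set (Fin n))ᶜ) (sel W) b)ᶜ ≤ t :=
  fun _ w A o b a₀ hbA hoA hlow ih ha₀A hmin hΨ => goodStepK13_of_lowFibres w A o b a₀ hbA hoA hlow ih ha₀A hmin hΨ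

end

end Summit.CriticalPhenomena.PercolationContinuityZ3.Theorems
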